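import Mathlib
import HarnessLib
import Summits.Parity.GeneralizedHardyLittlewood.Theses.ConstellationCubes

/-!
# Route `ConstellationCubes` — definitions for the glue of the rev-2 split of `CubeHL` (node «RelativeCubes», decomp-parity lens-4 g5)

Readable vocabulary used by the proof file `Theorems/ConstellationCubesCubeHLGlue.lean` (glue item `CubeHLGlue`,
stmt-Parity-30021: `OneClassHL → RelCube → CubeHL`).  The BORN items `OneClassHL` (30019) / `RelCube` (30020) /
`CubeHL` (28872) inline this vocabulary textually (the gate files fully-qualified texts); the objects below are the
abbreviations the cell kernel `HOME/decomp-parity-lens-4/g5/RelativeCubes.lean` (@5e250a400e2986d6, critic CLEARED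
STATUS l.248 / CRITIC-LEDGER row 52) works with: the cube predicate `IsCube`, the two-sided fixed-pattern conclusion
`HLFor`, and the support-pattern bookkeeping `vtx` / `vertices` / `cls` / `sub` (vertex of a form, vertex set, class of
forms at a vertex, the class as a re-indexed sub-system).  Definitions only; no statements.
-/

namespace Summit.Parity.GeneralizedHardyLittlewood.ConstellationCubesCubeHLGlue

open scoped BigOperators Classical
open Literature.NumberTheory.Sieve Finset

variable {d t : ℕ}

/-- The parent's inlined cube predicate: every form is an integer dilate of a cube-vertex form. -/
def IsCube (Ψ : Fin t → AffLinForm d) : Prop :=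
  ∀ i : Fin t, ∃ (a : ℤ) (ω : Fin d → ℤ),
    ((∀ j, ω j = 0 ∨ ω j = 1) ∧ ∀ j : Fin d, (j : ℕ) = 0 → ω j = 1) ∧ (Ψ i).coeff = a • ω

/-- The two-sided fixed-pattern HL conclusion for ONE system, uniform over convex `K ⊆ [−N,N]^d`. -/
def HLFor (Ψ : Fin t → AffLinForm d) : Prop :=
  ∀ ε : ℝ, 0 < ε → ∃ N₀ : ℕ, ∀ N : ℕ, N₀ ≤ N → ∀ K : Set (Fin d → ℝ), Convex ℝ K → K ⊆ realBox d N →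
    |vonMangoldtSum Ψ K N - archFactor Ψ K * singularProduct Ψ| ≤ ε * (N : ℝ) ^ d

/-- The SUPPORT PATTERN of form `i` (for a cube form `a•ω`, `a ≠ 0`, this is the vertex `ω`). -/
def vtx (Ψ : Fin t → AffLinForm d) (i : Fin t) : Fin d → ℤ :=
  fun j => if (Ψ i).coeff j = 0 then 0 else 1

/-- The vertex set of `Ψ` (support patterns that occur). -/
def vertices (Ψ : Fin t → AffLinForm d) : Finset (Fin d → ℤ) := univ.image (vtx Ψ)

/-- The class of forms sitting at vertex `ω`. -/
def cls (Ψ : Fin t → AffLinForm d) (ω : Fin d → ℤ) : Finset (Fin t) := univ.filter fun i => vtx Ψ i = ω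

/-- The class at `ω` as a system in its own right (re-indexed increasingly). -/
def sub (Ψ : Fin t → AffLinForm d) (ω : Fin d → ℤ) : Fin (cls Ψ ω).card → AffLinForm d :=
  fun k => Ψ ((cls Ψ ω).orderEmbOfFin rfl k)

end Summit.Parity.GeneralizedHardyLittlewood.ConstellationCubesCubeHLGlue
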